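import Summits.BirchSwinnertonDyer.BirchSwinnertonDyer.Theorems.Rank1ResidualX9TwistCriterion
import Literature.NumberTheory.QuadraticFields.KroneckerSplitting
import Literature.NumberTheory.QuadraticFields.DedekindZetaReducedForms
import Literature.NumberTheory.EllipticCurves.HeegnerPointsImaginaryQuadraticProofs
import Mathlib.NumberTheory.LegendreSymbol.JacobiSymbol
import HarnessLib

/-!
# Route `SignedBalanceX9`, crux `TwistedAnalyticMuZeroCoprimeX9` (item stmt-BirchSwinnertonDyer-25216),
# line `coprime-frame`: BRIDGE lemmas — the admissibility predicates `SplitsInQuadField` /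
# `InertInQuadField` versus the Jacobi symbol and versus the number of primes of a quadratic field

HONEST FRAMING: glue only (helper for the LEAD's stub K `stub_coprimeSplitDiscriminantSupply`, whose
source theorem `…BiquadraticEisensteinDescentHeegnerFieldSupplyEvenRung.exists_twoSplit_split_not_dvd_classNumber`
returns the splitting of `q` in `K` as `((Ideal.span {q}).primesOver (𝓞 K)).ncard = 2`, while
`BCSAdmissiblePair` wants `SplitsInQuadField d_K q`); 0 definitions, 0 named facts, 0 sorry. Nothing
here is about elliptic curves; no stub, crux, route or summit statement is proved; BSD is not proved
by any of this.

* `splitsInQuadField_iff_jacobiSym_eq_one` / `inertInQuadField_iff_jacobiSym_eq_neg_one` — at an odd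
  prime `q` the predicates of `Rank1ResidualX9TwistCriterion` (stated with `IsSquare (d : ZMod q)`)
  are the conditions `(d/q) = 1`, resp. `(d/q) = -1` on the Legendre (= Jacobi at a prime) symbol
  (Mathlib `legendreSym.eq_one_iff`, `legendreSym.eq_neg_one_iff`, `legendreSym.eq_zero_iff`).
* `splitsInQuadField_two_iff` / `inertInQuadField_two_iff` — at `q = 2` they are `d ≡ 1 (mod 8)`,
  resp. `d ≡ 5 (mod 8)`.
* `splitsInQuadField_discr_iff_ncard_primesOver_eq_two` — for a quadratic number field `K` and any
  prime `q`: `SplitsInQuadField (discr K) q ↔` there are two primes of `𝓞 K` above `q` (the tree's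
  decomposition law `Quadratic.ncard_primesOver_eq_two_iff_jacobiSym`, `…_two_eq_two_iff`), and the
  consumer-facing direction `splitsInQuadField_discr_of_ncard_primesOver_eq_two`.

* `classNumber_eq_of_isImaginaryQuadratic_of_discr_eq` /
  `forall_not_dvd_classNumber_of_isImaginaryQuadratic` — the class number of an imaginary quadratic
  field depends only on its discriminant (`h_K = h(d_K)`, Cox Thm. 7.7(ii) = the tree's
  `Quadratic.card_reducedForms_eq_classNumber`), so `p ∤ h_K` for ONE imaginary quadratic `K` of
  discriminant `d_K` is the crux's clause `∀ K', IsImaginaryQuadratic K' → discr K' = d_K → ¬ p ∣ h_{K'}`.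

References: Neukirch, *Algebraic Number Theory* I.8.5; Cox, *Primes of the form x² + ny²*, Thm. 7.7(ii); Marcus, *Number Fields*, Ch. 3 Thm. 25;
Ireland–Rosen Prop. 13.1.3–13.1.4 (decomposition law in quadratic fields).
-/

-- the summit and its single problem are both named `BirchSwinnertonDyer` (registry layout D-0017)
set_option linter.dupNamespace false
set_option autoImplicit false

open scoped NumberField
open Module NumberField
open Literature.NumberTheory.QuadraticFields
open Literature.NumberTheory.EllipticCurves (IsImaginaryQuadratic)

namespace Summit.BirchSwinnertonDyer.BirchSwinnertonDyer.Rank1Residual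

/-- At an odd prime `q`: `q` splits in `ℚ(√d)` in the sense of `SplitsInQuadField` (`q ∤ d` and `d`
a square mod `q`) iff the Jacobi symbol `J(d | q) = 1` (= the Legendre symbol at a prime).
Neukirch I.8.5; Mathlib `legendreSym.eq_one_iff`. [folklore] -/
theorem splitsInQuadField_iff_jacobiSym_eq_one {d : ℤ} {q : ℕ} (hq : q.Prime) (hq2 : q ≠ 2) :
    SplitsInQuadField d q ↔ jacobiSym d q = 1 := by
  haveI := Fact.mk hq
  rw [← jacobiSym.legendreSym.to_jacobiSym]
  constructor
  · rintro ⟨hnd, -, hsq⟩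
    have h0 : (d : ZMod q) ≠ 0 := fun h => hnd ((ZMod.intCast_zmod_eq_zero_iff_dvd d q).mp h)
    exact (legendreSym.eq_one_iff q h0).mpr (hsq hq2)
  · intro h1
    have h0 : (d : ZMod q) ≠ 0 := fun h0 => by
      rw [(legendreSym.eq_zero_iff q d).mpr h0] at h1
      exact absurd h1 (by decide)
    exact ⟨fun hdvd => h0 ((ZMod.intCast_zmod_eq_zero_iff_dvd d q).mpr hdvd), fun h => absurd h hq2,
      fun _ => (legendreSym.eq_one_iff q h0).mp h1⟩

/-- At an odd prime `q`: `q` is inert in `ℚ(√d)` in the sense of `InertInQuadField` (`q ∤ d` and `d`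
a non-square mod `q`) iff the Jacobi symbol `J(d | q) = -1`. Neukirch I.8.5; Mathlib
`legendreSym.eq_neg_one_iff`. [folklore] -/
theorem inertInQuadField_iff_jacobiSym_eq_neg_one {d : ℤ} {q : ℕ} (hq : q.Prime) (hq2 : q ≠ 2) :
    InertInQuadField d q ↔ jacobiSym d q = -1 := by
  haveI := Fact.mk hq
  rw [← jacobiSym.legendreSym.to_jacobiSym, legendreSym.eq_neg_one_iff]
  constructor
  · rintro ⟨-, -, hns⟩
    exact hns hq2
  · intro hns
    refine ⟨fun hdvd => hns ?_, fun h => absurd h hq2, fun _ => hns⟩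
    rw [(ZMod.intCast_zmod_eq_zero_iff_dvd d q).mpr hdvd]
    exact IsSquare.zero

/-- At `q = 2`: `2` splits in `ℚ(√d)` in the sense of `SplitsInQuadField` iff `d ≡ 1 (mod 8)`.
Neukirch I.8.5. [folklore] -/
theorem splitsInQuadField_two_iff {d : ℤ} : SplitsInQuadField d 2 ↔ d % 8 = 1 := by
  constructor
  · rintro ⟨-, h8, -⟩
    exact h8 rfl
  · intro h8
    exact ⟨by omega, fun _ => h8, fun h => absurd rfl h⟩

/-- At `q = 2`: `2` is inert in `ℚ(√d)` in the sense of `InertInQuadField` iff `d ≡ 5 (mod 8)`.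
Neukirch I.8.5. [folklore] -/
theorem inertInQuadField_two_iff {d : ℤ} : InertInQuadField d 2 ↔ d % 8 = 5 := by
  constructor
  · rintro ⟨-, h8, -⟩
    exact h8 rfl
  · intro h8
    exact ⟨by omega, fun _ => h8, fun h => absurd rfl h⟩

/-- **Decomposition law, in the currency of `BCSAdmissiblePair`.** For a quadratic number field `K`
and a prime `q`: `SplitsInQuadField (d_K) q` iff there are exactly two primes of `𝓞 K` above `q`
(odd `q`: `Quadratic.ncard_primesOver_eq_two_iff_jacobiSym`; `q = 2`:
`Quadratic.ncard_primesOver_two_eq_two_iff`). Marcus Ch. 3 Thm. 25. [folklore] -/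
theorem splitsInQuadField_discr_iff_ncard_primesOver_eq_two {K : Type*} [Field K] [NumberField K]
    (h2 : finrank ℚ K = 2) {q : ℕ} (hq : q.Prime) :
    SplitsInQuadField (NumberField.discr K) q ↔
      ((Ideal.span {(q : ℤ)}).primesOver (𝓞 K)).ncard = 2 := by
  by_cases hq2 : q = 2
  · subst hq2
    rw [splitsInQuadField_two_iff, Nat.cast_ofNat, Quadratic.ncard_primesOver_two_eq_two_iff h2]
  · rw [splitsInQuadField_iff_jacobiSym_eq_one hq hq2,
      Quadratic.ncard_primesOver_eq_two_iff_jacobiSym h2 hq hq2]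

/-- Consumer-facing direction: two primes of `𝓞 K` above the prime `q` (`K` quadratic) give
`SplitsInQuadField (d_K) q` — the shape in which `exists_twoSplit_split_not_dvd_classNumber`
(route `BiquadraticEisensteinDescent`) delivers its split primes, turned into the clause of
`BCSAdmissiblePair`. [folklore] -/
theorem splitsInQuadField_discr_of_ncard_primesOver_eq_two {K : Type*} [Field K] [NumberField K]
    (h2 : finrank ℚ K = 2) {q : ℕ} (hq : q.Prime)
    (h : ((Ideal.span {(q : ℤ)}).primesOver (𝓞 K)).ncard = 2) :
    SplitsInQuadField (NumberField.discr K) q :=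
  (splitsInQuadField_discr_iff_ncard_primesOver_eq_two h2 hq).mpr h


/-- **The class number of an imaginary quadratic field depends only on its discriminant**: two
imaginary quadratic fields with the same `d_K` have the same class number, both being the number
`h(d_K)` of reduced primitive positive definite forms of discriminant `d_K` (Cox Thm. 2.13 and
Thm. 7.7(ii) `C(d_K) ≅ C(𝒪_K)`: the tree's `Quadratic.card_reducedForms_eq_classNumber`). (The two
fields are of course isomorphic, `K ≅ ℚ(√d_K)`; only the class-number consequence is recorded.)
[cite: Cox2013, §7.B Thm. 7.7(ii)] -/
theorem classNumber_eq_of_isImaginaryQuadratic_of_discr_eq {K : Type*} [Field K] [NumberField K]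
    {K' : Type*} [Field K'] [NumberField K'] (hK : IsImaginaryQuadratic K)
    (hK' : IsImaginaryQuadratic K') (hd : NumberField.discr K' = NumberField.discr K) :
    NumberField.classNumber K' = NumberField.classNumber K := by
  rw [← Quadratic.card_reducedForms_eq_classNumber hK.1 hK.discr_neg,
    ← Quadratic.card_reducedForms_eq_classNumber hK'.1 hK'.discr_neg, hd]

/-- Consumer-facing form of the previous lemma, in the shape of the class-number clause of crux
`TwistedAnalyticMuZeroCoprimeX9` / stub K: if ONE imaginary quadratic field `K` of discriminant
`d_K` has `ℓ ∤ h_K` (e.g. the field delivered by `exists_twoSplit_split_not_dvd_classNumber`), then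
EVERY imaginary quadratic `K'` with `discr K' = d_K` has `ℓ ∤ h_{K'}`. [cite: Cox2013, §7.B Thm. 7.7(ii)] -/
theorem forall_not_dvd_classNumber_of_isImaginaryQuadratic {ℓ : ℕ} {K : Type*} [Field K]
    [NumberField K] (hK : IsImaginaryQuadratic K) (hℓ : ¬ ℓ ∣ NumberField.classNumber K) :
    ∀ (K' : Type) [Field K'] [NumberField K'], IsImaginaryQuadratic K' →
      NumberField.discr K' = NumberField.discr K → ¬ ℓ ∣ NumberField.classNumber K' := by
  intro K' _ _ hK' hd
  rwa [classNumber_eq_of_isImaginaryQuadratic_of_discr_eq hK hK' hd]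

end Summit.BirchSwinnertonDyer.BirchSwinnertonDyer.Rank1Residual
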